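import Summits.CriticalPhenomena.PercolationContinuityZ3.Theorems.PercNearOneGluingNoHeavyQuantLawDEC
import HarnessLib

/-!
# QUANT lane R8, T-DEC: BLOB-DEC FOR FAIR COINS — for EVERY number of blobs, EVERY sizes and EVERY layer, the law of
# `Σ aᵢ·Bernoulli(1/2)` is DEC(j′) at floor `1/2` (the antipodal coupling `W ↦ Wᶜ`)

builds on p205010 (kernel theorem, internal audit signed; external expert review pending)

Support file (`--supports stmt-CriticalPhenomena-4575`), QUANT lane seat prim-quant-census-2 (gen 52), rung R8 of
`run/shared/lean/prim/quant/LADDER.md`.  Memo `run/shared/lean/prim/quant/prim-quant-census-2-g52/DEC-CRITERIA-G52.md` §4.3 (the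
tied `y = 1/2` systems are an exactly tight family of Conjecture BLOB-DEC(k): the low patterns are paid for by their complements).
Theorems only (no definitions), standard axioms.

THE LAW.  `k` blobs of sizes `a : Fin k → ℕ`, every gate `1/2`: the count law is `μ(h) = 2^{−k}·#{W ⊆ [k] : a(W) = h}`, written here as
`h ↦ Σ_{W : Finset (Fin k)} [Σ_{i∈W} a i = h]·(1/2)^k`, on `{0..A}`, `A = Σ a i`, mean `A/2`.
**THEOREM `FairCoin.decAt_half` : `Quant.LawDec.DECAt (1/2) j′ A μ` for every `j′`.**  Witness (ANTIPODAL COUPLING): one component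
per pattern `W`, weight `2^{−k}`, gate `1/2`, atoms `{min(a(W), a(Wᶜ)), max(a(W), a(Wᶜ))}`; the involution `W ↦ Wᶜ` shows that this
mixture is `μ`; each component is valid at `(1/2, A/2, j′)`: a point mass sits at `A/2` (rule (S)); a pair `{ℓ, A−ℓ}` with `A − ℓ ≥ j′+1` is
giant-heavy (rule (G), gate `1/2 ≥` floor); otherwise it is a non-giant pair with credit `2ℓ + (A − 2ℓ)/2 = ℓ + A/2 ≥ A/2` (rule (N)).
This is the first DEC(j′) theorem for an arbitrary number of blobs (the case `k = 2` at every floor is `Quant.BlobDec2.decAt_all`); it does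
not extend to floors `≠ 1/2` by the same map (the complement of a many-small-blobs pattern is too light, DEC-CRITERIA-G52 §4.4).

[this work]; DEC rules ARCH-TREES-G49 §2.2 / DEC-TAMP-G50 §3.1 (this lane).  The gluing rows served
[cite: KozmaNitzan2024, Conjecture 3 (p. 15)]; product measure [cite: Grimmett1999, §1.3 p. 10].
-/

noncomputable section

namespace Summit.CriticalPhenomena.PercolationContinuityZ3.Theorems

namespace Quant

open Finset

/-- the two-point law `{lo, hi; g}` (as in `…QuantLawDEC`) -/
local notation3 "TP[" lo ", " hi ", " g ", " h "]" =>
  (g : ℝ) * (if (h : ℕ) = (hi : ℕ) then (1 : ℝ) else 0) + (1 - (g : ℝ)) * (if (h : ℕ) = (lo : ℕ) then (1 : ℝ) else 0)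

/-- the fair-coin law of sizes `a : Fin k → ℕ` evaluated at `h` -/
local notation3 "FAIR[" k ", " a ", " h "]" =>
  ∑ W : Finset (Fin k), (if ∑ i ∈ W, (a : Fin k → ℕ) i = (h : ℕ) then ((1 : ℝ) / 2) ^ (k : ℕ) else 0)

namespace FairCoin

variable {k : ℕ}

/-- complement sums: `a(Wᶜ) = A − a(W)` in `ℕ`. [folklore] -/
theorem sum_compl_eq (a : Fin k → ℕ) (W : Finset (Fin k)) : ∑ i ∈ Wᶜ, a i = ∑ i, a i - ∑ i ∈ W, a i := by
  have := Finset.sum_compl_add_sum W a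
  omega

/-- a partial sum of the sizes is at most the total. [folklore] -/
theorem sum_le_total (a : Fin k → ℕ) (W : Finset (Fin k)) : ∑ i ∈ W, a i ≤ ∑ i, a i :=
  Finset.sum_le_sum_of_subset_of_nonneg (Finset.subset_univ W) fun _ _ _ => Nat.zero_le _

/-- **Mean of the fair-coin law**: `Σ_{h ≤ A} h·μ(h) = A/2` (pair `W` with `Wᶜ`). [this work] -/
theorem mean_eq (a : Fin k → ℕ) :
    ∑ h ∈ Finset.range ((∑ i, a i) + 1), (h : ℝ) * FAIR[k, a, h] = (∑ i, a i : ℕ) / 2 := by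
  classical
  -- exchange the sums: Σ_h h·Σ_W [a W = h] c = Σ_W c·a(W)
  have e1 : ∑ h ∈ Finset.range ((∑ i, a i) + 1), (h : ℝ) * FAIR[k, a, h]
      = ∑ W : Finset (Fin k), ((1 : ℝ) / 2) ^ k * ((∑ i ∈ W, a i : ℕ) : ℝ) := by
    simp_rw [Finset.mul_sum]
    rw [Finset.sum_comm]
    refine Finset.sum_congr rfl fun W _ => ?_
    rw [Finset.sum_eq_single (∑ i ∈ W, a i)]
    · rw [if_pos rfl]; ring
    · intro h _ hne; rw [if_neg (Ne.symm hne), mul_zero]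
    · intro hn; exfalso; exact hn (Finset.mem_range.2 (Nat.lt_succ_of_le (sum_le_total a W)))
  rw [e1]
  -- Σ_W a(W) = Σ_W a(Wᶜ) = Σ_W (A − a(W))
  have e2 : ∑ W : Finset (Fin k), ((1 : ℝ) / 2) ^ k * ((∑ i ∈ W, a i : ℕ) : ℝ)
      = ∑ W : Finset (Fin k), ((1 : ℝ) / 2) ^ k * ((∑ i ∈ Wᶜ, a i : ℕ) : ℝ) :=
    (Fintype.sum_equiv (Equiv.ofBijective _ compl_bijective) _ _ (fun W => rfl)).symm
  have e3 : ∀ W : Finset (Fin k), ((∑ i ∈ Wᶜ, a i : ℕ) : ℝ) = ((∑ i, a i : ℕ) : ℝ) - ((∑ i ∈ W, a i : ℕ) : ℝ) := by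
    intro W
    have h := Finset.sum_compl_add_sum W a
    have : ((∑ i ∈ Wᶜ, a i : ℕ) : ℝ) + ((∑ i ∈ W, a i : ℕ) : ℝ) = ((∑ i, a i : ℕ) : ℝ) := by exact_mod_cast h
    linarith
  have e4 : ∑ W : Finset (Fin k), ((1 : ℝ) / 2) ^ k * ((∑ i ∈ W, a i : ℕ) : ℝ)
      + ∑ W : Finset (Fin k), ((1 : ℝ) / 2) ^ k * ((∑ i ∈ Wᶜ, a i : ℕ) : ℝ)
      = ∑ W : Finset (Fin k), ((1 : ℝ) / 2) ^ k * ((∑ i, a i : ℕ) : ℝ) := by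
    rw [← Finset.sum_add_distrib]
    refine Finset.sum_congr rfl fun W _ => ?_
    rw [e3]; ring
  have e5 : ∑ W : Finset (Fin k), ((1 : ℝ) / 2) ^ k * ((∑ i, a i : ℕ) : ℝ) = ((∑ i, a i : ℕ) : ℝ) := by
    rw [Finset.sum_const, Finset.card_univ, Fintype.card_finset, Fintype.card_fin, nsmul_eq_mul]
    push_cast
    rw [← mul_assoc, ← mul_pow]; norm_num
  linarith [e2, e4, e5]

/-- **BLOB-DEC FOR FAIR COINS (every `k`, every sizes, every layer).**  See the file header. [this work] -/
theorem decAt_half (a : Fin k → ℕ) (j' : ℕ) :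
    LawDec.DECAt (1 / 2) j' (∑ i, a i) (fun h => FAIR[k, a, h]) := by
  classical
  have hmean : ∑ h ∈ Finset.range ((∑ i, a i) + 1), (h : ℝ) * (fun h => FAIR[k, a, h]) h = (∑ i, a i : ℕ) / 2 := mean_eq a
  refine ⟨Finset (Fin k), inferInstance, fun _ => ((1 : ℝ) / 2) ^ k, fun _ => 1 / 2,
    fun W => min (∑ i ∈ W, a i) (∑ i ∈ Wᶜ, a i), fun W => max (∑ i ∈ W, a i) (∑ i ∈ Wᶜ, a i),
    fun _ => by positivity, ?_, fun _ => ⟨by norm_num, by norm_num⟩, fun _ => min_le_max, fun W => ?_, fun h => ?_, ?_⟩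
  · -- total weight
    rw [Finset.sum_const, Finset.card_univ, Fintype.card_finset, Fintype.card_fin, nsmul_eq_mul]
    push_cast
    rw [← mul_pow]; norm_num
  · -- hi ≤ A
    exact max_le (sum_le_total a W) (sum_le_total a Wᶜ)
  · -- the mixture identity via the involution `W ↦ Wᶜ`
    show FAIR[k, a, h] = ∑ W : Finset (Fin k), ((1 : ℝ) / 2) ^ k *
      TP[min (∑ i ∈ W, a i) (∑ i ∈ Wᶜ, a i), max (∑ i ∈ W, a i) (∑ i ∈ Wᶜ, a i), ((1 : ℝ) / 2), h]
    -- each component puts half of its weight on `a(W)` and half on `a(Wᶜ)`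
    have e1 : ∀ W : Finset (Fin k), ((1 : ℝ) / 2) ^ k *
        TP[min (∑ i ∈ W, a i) (∑ i ∈ Wᶜ, a i), max (∑ i ∈ W, a i) (∑ i ∈ Wᶜ, a i), ((1 : ℝ) / 2), h]
        = ((1 : ℝ) / 2) ^ k * (1 / 2) * (if h = ∑ i ∈ W, a i then (1 : ℝ) else 0)
          + ((1 : ℝ) / 2) ^ k * (1 / 2) * (if h = ∑ i ∈ Wᶜ, a i then (1 : ℝ) else 0) := by
      intro W
      rcases le_total (∑ i ∈ W, a i) (∑ i ∈ Wᶜ, a i) with hle | hle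
      · rw [min_eq_left hle, max_eq_right hle]; ring
      · rw [min_eq_right hle, max_eq_left hle]; ring
    rw [Finset.sum_congr rfl (fun W _ => e1 W), Finset.sum_add_distrib]
    have e2 : ∑ W : Finset (Fin k), ((1 : ℝ) / 2) ^ k * (1 / 2) * (if h = ∑ i ∈ Wᶜ, a i then (1 : ℝ) else 0)
        = ∑ W : Finset (Fin k), ((1 : ℝ) / 2) ^ k * (1 / 2) * (if h = ∑ i ∈ W, a i then (1 : ℝ) else 0) :=
      Fintype.sum_equiv (Equiv.ofBijective _ compl_bijective) _ _ (fun W => rfl)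
    rw [e2, ← two_mul, Finset.mul_sum]
    refine Finset.sum_congr rfl fun W _ => ?_
    by_cases hW : ∑ i ∈ W, a i = h
    · rw [if_pos hW, if_pos hW.symm]; ring
    · rw [if_neg hW, if_neg (fun h' => hW h'.symm)]; ring
  · -- validity of every component at `(1/2, A/2, j′)`
    rw [hmean]
    intro W _
    dsimp only
    have hc : ((∑ i ∈ Wᶜ, a i : ℕ) : ℝ) + ((∑ i ∈ W, a i : ℕ) : ℝ) = ((∑ i, a i : ℕ) : ℝ) := by
      exact_mod_cast Finset.sum_compl_add_sum W a
    rcases lt_trichotomy (∑ i ∈ W, a i) (∑ i ∈ Wᶜ, a i) with hlt | heq | hgt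
    · rw [min_eq_left hlt.le, max_eq_right hlt.le]
      by_cases hj : j' + 1 ≤ ∑ i ∈ Wᶜ, a i
      · exact Or.inr (Or.inl ⟨hlt, hj, le_rfl⟩)
      · refine Or.inr (Or.inr ⟨hlt, by omega, ?_⟩)
        rw [if_pos le_rfl]
        have : ((∑ i ∈ W, a i : ℕ) : ℝ) < ((∑ i ∈ Wᶜ, a i : ℕ) : ℝ) := by exact_mod_cast hlt
        linarith
    · rw [min_eq_left heq.le, max_eq_right heq.le]
      refine Or.inl ⟨heq, Or.inl ?_⟩
      have : ((∑ i ∈ W, a i : ℕ) : ℝ) = ((∑ i ∈ Wᶜ, a i : ℕ) : ℝ) := by exact_mod_cast heq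
      linarith
    · rw [min_eq_right hgt.le, max_eq_left hgt.le]
      by_cases hj : j' + 1 ≤ ∑ i ∈ W, a i
      · exact Or.inr (Or.inl ⟨hgt, hj, le_rfl⟩)
      · refine Or.inr (Or.inr ⟨hgt, by omega, ?_⟩)
        rw [if_pos le_rfl]
        have : ((∑ i ∈ Wᶜ, a i : ℕ) : ℝ) < ((∑ i ∈ W, a i : ℕ) : ℝ) := by exact_mod_cast hgt
        linarith

end FairCoin

end Quant

end Summit.CriticalPhenomena.PercolationContinuityZ3.Theorems
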